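import Summits.BirchSwinnertonDyer.BirchSwinnertonDyer.Theorems.PrintCf2SplitBadTwoRestrictedSelmerBaseLiftOfLocSurj
import Summits.BirchSwinnertonDyer.Rank1Residual.X11b.ProcyclicDescentRescaled
import Literature.NumberTheory.EllipticCurves.Rubin1991.TwoVariableSelmerCoefficientTwist
import Literature.NumberTheory.EllipticCurves.KellerYin2024.CharacterSelmerGroups
import HarnessLib

/-!
# Crux `PrintCf2.SplitBadTwoRankOneOfFacts` (stmt-BirchSwinnertonDyer-20368), skeleton v13, stub S3d `stub_strictDefectAtVbar_two`, class (iii),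
# file 1 of 3: THE UNRAMIFIED LOCAL LIFT at the distinguished place `𝔮` for the line group `S_M(K_∞) = H¹_{𝓕_nr}(K_∞, M)` (generic)

Cell `bsd-print-cf2`, EXTRA WIDTH seat `bsd-line-cf2-p1-w4` g11 (prover-bsd-line-cf2-p1-w4-g11-0); `--supports stmt-BirchSwinnertonDyer-20368`
(helper, Theses-free). HONEST FRAMING: nothing here closes the crux or a registered stub; BSD is not proved by any of this; no summit statement
is proved by this seat. No definition, no named fact, no `sorry`.

WHY (S3d, LEAD rulings 01:48:57Z / 02:16:44Z / 02:30:44Z; -w3 g11's spine p690534, 02:47:23Z). With the spine `n′ = n + χ_Γ(Q)`,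
`Q := S_{W*}(K*_∞) ⧸ 𝔖_{v̄}(K*_∞, W*)`, the number `e_δ` of S3d is `log₂ #Q^Γ − log₂ #Q_Γ`; on class (iii) (`d ≡ 3 (8)`, `14 (16)`) `Q` embeds
`Γ`-equivariantly in the local defect group `𝓛 ≅ W* ≅ ℚ₂/ℤ₂(u)`, `v₂(u − 1) = 2`, so `e_δ ∈ {0, 2}` according as `Q` is finite or all of `𝓛`, and
class-uniformity IS «`Q` infinite» ⟺ «`Q_Γ = 0`». `Q_Γ` is a quotient of `(S_nr)_Γ`, and this series of three files proves **`(S_nr)_Γ = 0`** WITHOUT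
any global-to-local surjectivity over the line (GV 2000 Prop. 2.1, absent from the tree): exactly as B17 obtained `𝔖_Γ = 0` (-w4 g8
`forall_finite_eq_bot_of_subsingleton_H2_of_baseLift`, -w4 g9 `baseLift_of_locSurj`), from (β)_nr «every `c ∈ H¹(K_∞, M)` with `conj_γ c − c ∈ S_nr`
is congruent mod `S_nr` to a class restricted from `K`» and `H¹(K_∞, M)_Γ = 0` (`H²(Γ_K, M) = 0`, X11b procyclic descent). The ONE new ingredient
w.r.t. the strict version is the local lift at the distinguished place `𝔮` for the UNRAMIFIED condition: `x := res_{D″} c` is `D_𝔮`-invariant only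
modulo `𝓛`; the displayed local hypothesis h𝓛 («`conj_δ − 1` is onto `𝓛` for `δ ∈ D_𝔮 ∖ ker κ`», true in class (iii)) corrects it by an
`ℓ ∈ 𝓛`, and the rescaled procyclic descent (`X11b.ProcyclicDescent.rescale`) lifts the corrected class to `H¹(D_𝔮, M)`.

CONTENT (generic: `K` a number field, `p`, `κ : ZpExtension K p`, `M` a `p`-primary discrete `Γ_K`-module with open stabilisers, `𝔮 ∣ p`;
`S_nr := KellerYin2024.unrSelmer κ M 𝔮 ∅ = datumSelmer (ker κ) M p (bdpData M p 𝔮) ∅`; `D″ = Coinv.kerD κ 𝔮`, `I = ker κ ⊓ I_𝔮`,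
`ρ : H¹(D″, M) → H¹(I, M)` the restriction along `Coinv.toKerD`):
* `conjH1_sub_mem_of_isTopGenerator` (all conjugates of `c` agree with `c` modulo a `Γ_K`-stable subgroup once `conj_γ c − c` lies in it —
  -w4 g9's step (2) for an arbitrary subgroup), `conjH1_mem_unrSelmer`;
* `toKerD_comp_resKerD` / `toKerD_comp_resSubgroup` (the two restriction triangles at `𝔮`), `resOfLe_inertia_eq_zero_of_mem_unrSelmer`,
  `mem_unramifiedKer_of_mem_unrSelmer`, `mem_unrSelmer_of_local` (membership in `S_nr` from the local conditions at the chosen places; at the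
  other primes above `p` Castella's datum is relaxed), `oneCocycleClass_mem_unramifiedKer_of_inertia_le`;
* `exists_resSubgroup_kerD_eq_of_forall_local` (the strict local lift from LOCAL invariance only);
* **`exists_resSubgroup_kerD_eq_sub_of_unr`**, **`exists_resOfLe_inertia_eq_of_unr`** — the unramified local lift at `𝔮` from h𝓛.
Files 2–3: `…UnrBaseLift` ((β)_nr and `(S_nr)_Γ = 0`), `…UnrCoinvariantsFrame` (road α, everything but h𝓛 discharged).
presearch: JSW17 Lemma 3.3.3 + Prop. 3.3.2 (arXiv:1512.06894 pp. 11–12); Greenberg LNM 1716 §4 pp. 122–125; GV 2000 §2 Prop. 2.1 (pp. 17–19: the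
printed alternative, finite-level Poitou–Tate for twists — not used); held, no new fact. beyond-print theorem: no.

References: [JetchevSkinnerWan2017] Lemma 3.3.3, Prop. 3.3.2; [GreenbergLNM1716] §4 Props. 4.13–4.15; [GreenbergVatsal2000] §2 pp. 17–21;
[Agboola2007] §3 Prop. 3.2, §5 Prop. 5.1; [SerreGaloisCohomology1997] I §2.5–2.6.
-/

noncomputable section

open scoped Classical

set_option linter.dupNamespace false
set_option autoImplicit false

open NumberField IsDedekindDomain Field WeierstrassCurve
open Literature.NumberTheory.EllipticCurves Literature.NumberTheory.EllipticCurves.GreenbergSelmer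
open Literature.NumberTheory.EllipticCurves.GreenbergVatsal2000 Literature.NumberTheory.EllipticCurves.KellerYin2024
open Literature.NumberTheory.EllipticCurves.Agboola2007
open Literature.NumberTheory.EllipticCurves.IwasawaDual
open Literature.NumberTheory.GaloisRepresentations
open Summit.BirchSwinnertonDyer.Rank1Residual.X11b
open Summit.BirchSwinnertonDyer.BirchSwinnertonDyer.Theorems.PrintCf2.RestrictedSelmerPair

namespace Summit.BirchSwinnertonDyer.BirchSwinnertonDyer.Theorems.PrintCf2.UnrBaseLift

/-! ## §1. Generic local bookkeeping -/

section Generic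

variable {K : Type} [Field K] [NumberField K] {p : ℕ} [Fact p.Prime] (κ : ZpExtension K p)
  (M : Type) [AddCommGroup M] [DistribMulAction (absoluteGaloisGroup K) M] [TopologicalSpace M]
  [DiscreteTopology M] (𝔮 : HeightOneSpectrum (𝓞 K))

/-- **All conjugates of `c` agree with `c` modulo a `Γ_K`-stable subgroup `S ≤ H¹(K_∞, M)` when `conj_γ c − c ∈ S` for a topological
generator `γ`**: powers of `γ` by induction, an open layer subgroup fixes `c` (-w4 g9's `exists_forall_mem_layerSubgroup_conjH1_eq_of_isOpen`), and
`Γ_K = Gal(K̄/K_a)·γ^ℕ`. The `𝔖`-version is -w4 g9's `conjH1_sub_mem_restrictedSelmerZp_of_isTopGenerator`; here `S` is arbitrary.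
[cite: JetchevSkinnerWan2017, Lemma 3.3.3 (arXiv:1512.06894 p. 12)] [cite: SerreGaloisCohomology1997, I §2.6 (b)] -/
theorem conjH1_sub_mem_of_isTopGenerator (S : AddSubgroup (subgroupH1 κ.kerSubgroup M))
    (hS : ∀ (g : absoluteGaloisGroup K) (c : subgroupH1 κ.kerSubgroup M), c ∈ S → conjH1 κ.kerSubgroup M g c ∈ S)
    (hstab : ∀ m : M, IsOpen (MulAction.stabilizer (absoluteGaloisGroup K) m : Set (absoluteGaloisGroup K)))
    {γ : absoluteGaloisGroup K} (hγ : κ.IsTopGenerator γ) {c : subgroupH1 κ.kerSubgroup M}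
    (hc : conjH1 κ.kerSubgroup M γ c - c ∈ S) (g : absoluteGaloisGroup K) :
    conjH1 κ.kerSubgroup M g c - c ∈ S := by
  have hpow : ∀ k : ℕ, conjH1 κ.kerSubgroup M (γ ^ k) c - c ∈ S := by
    intro k
    induction k with
    | zero =>
      rw [pow_zero, Literature.NumberTheory.EllipticCurves.conjH1_one_holds κ.kerSubgroup M, AddMonoidHom.id_apply, sub_self]
      exact zero_mem _
    | succ k ih =>
      have e : conjH1 κ.kerSubgroup M (γ ^ (k + 1)) c - c =
          conjH1 κ.kerSubgroup M γ (conjH1 κ.kerSubgroup M (γ ^ k) c - c) + (conjH1 κ.kerSubgroup M γ c - c) := by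
        rw [pow_succ', Literature.NumberTheory.EllipticCurves.conjH1_mul_holds κ.kerSubgroup M, AddMonoidHom.comp_apply, map_sub]
        abel
      rw [e]
      exact add_mem (hS γ _ ih) hc
  obtain ⟨a, ha⟩ := exists_forall_mem_layerSubgroup_conjH1_eq_of_isOpen κ M hstab c
  obtain ⟨h, hh, k, rfl⟩ := Coinv.exists_mem_layerSubgroup_mul_pow p κ hγ a g
  have e : conjH1 κ.kerSubgroup M (h * γ ^ k) c - c = conjH1 κ.kerSubgroup M h (conjH1 κ.kerSubgroup M (γ ^ k) c - c) := by
    rw [Literature.NumberTheory.EllipticCurves.conjH1_mul_holds κ.kerSubgroup M, AddMonoidHom.comp_apply, map_sub, ha h hh]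
  rw [e]
  exact hS h _ (hpow k)

/-- `S_nr = H¹_{𝓕_nr}(K_∞, M)` is `Γ_K`-stable (`GreenbergVatsal2000.conjH1_mem_datumSelmer`). [cite: GreenbergVatsal2000, §2 p. 17] -/
theorem conjH1_mem_unrSelmer (g : absoluteGaloisGroup K) {c : subgroupH1 κ.kerSubgroup M} (hc : c ∈ unrSelmer κ M 𝔮 ∅) :
    conjH1 κ.kerSubgroup M g c ∈ unrSelmer κ M 𝔮 ∅ :=
  conjH1_mem_datumSelmer κ.kerSubgroup M p _ ∅ g hc

/-- `ker κ ⊓ I_𝔮 ≤ D_𝔮`. [cite: NeukirchANT1999, Ch. I §9 (9.5)] -/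
theorem kerSubgroup_inf_inertia_le_decomp : κ.kerSubgroup ⊓ inertia 𝔮 ≤ decomp 𝔮 :=
  fun _ hx ↦ inertia_le_decomp 𝔮 (Subgroup.mem_inf.1 hx).2

/-- **The restriction triangle `H¹(K_∞, M) → H¹(D″, M) → H¹(I, M)`** (`D″ = ker κ ∩ D_𝔮`, `I = ker κ ∩ I_𝔮`): composing Coinv's `resKerD` with
the restriction along `Coinv.toKerD` is the plain restriction `res_{I ≤ ker κ}`. [cite: SerreGaloisCohomology1997, I §2.5] -/
theorem toKerD_comp_resKerD :
    (resH1Hom (Coinv.toKerD κ 𝔮 (kerSubgroup_inf_inertia_le_decomp κ 𝔮) (inf_le_left : κ.kerSubgroup ⊓ inertia 𝔮 ≤ κ.kerSubgroup))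
        (AddMonoidHom.id M) (fun _ _ ↦ rfl)).comp (Coinv.resKerD κ M 𝔮) =
      resOfLe M (inf_le_left : κ.kerSubgroup ⊓ inertia 𝔮 ≤ κ.kerSubgroup) := by
  rw [Literature.NumberTheory.EllipticCurves.resOfLe, Coinv.resKerD, resH1Hom_comp]
  exact resH1Hom_congr (ContinuousMonoidHom.ext fun _ ↦ rfl) (AddMonoidHom.ext fun _ ↦ rfl) _ _

/-- **The restriction triangle `H¹(D_𝔮, M) → H¹(D″, M) → H¹(I, M)`**: composing `res_{D_𝔮 → D″}` with the restriction along `Coinv.toKerD` is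
the plain restriction `res_{I ≤ D_𝔮}`. [cite: SerreGaloisCohomology1997, I §2.5] -/
theorem toKerD_comp_resSubgroup :
    (resH1Hom (Coinv.toKerD κ 𝔮 (kerSubgroup_inf_inertia_le_decomp κ 𝔮) (inf_le_left : κ.kerSubgroup ⊓ inertia 𝔮 ≤ κ.kerSubgroup))
        (AddMonoidHom.id M) (fun _ _ ↦ rfl)).comp (ResKernel.resSubgroup (Coinv.kerD κ 𝔮) M) =
      resOfLe M (kerSubgroup_inf_inertia_le_decomp κ 𝔮) := by
  rw [Literature.NumberTheory.EllipticCurves.resOfLe, ResKernel.resSubgroup, resH1Hom_comp]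
  exact resH1Hom_congr (ContinuousMonoidHom.ext fun _ ↦ rfl) (AddMonoidHom.ext fun _ ↦ rfl) _ _

variable {κ M 𝔮} in
/-- **A class of `S_nr` is unramified at the chosen place above `𝔮`**: `res_{ker κ ∩ I_𝔮} s = 0` (the Greenberg condition of Castella's
strict datum `M⁺ = 0` at `𝔮`, Rubin1991 `mem_greenbergKer_strictDatum_iff_resOfLe`, at the conjugate `σ = 1`).
[cite: GreenbergVatsal2000, §2 pp. 16–17] [cite: Castella2018, Def. 2.2] -/
theorem resOfLe_inertia_eq_zero_of_mem_unrSelmer (h𝔮 : ((p : ℕ) : 𝓞 K) ∈ 𝔮.asIdeal) {s : subgroupH1 κ.kerSubgroup M}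
    (hs : s ∈ unrSelmer κ M 𝔮 ∅) : resOfLe M (inf_le_left : κ.kerSubgroup ⊓ inertia 𝔮 ≤ κ.kerSubgroup) s = 0 := by
  have h := ((mem_datumSelmer_iff s).1 hs).2 𝔮 h𝔮 1
  rw [Literature.NumberTheory.EllipticCurves.conjH1_one_holds κ.kerSubgroup M, AddMonoidHom.id_apply,
    Castella2018.AcSelmer.bdpData_self p 𝔮 h𝔮, mem_greenbergKer_strictDatum_iff_resOfLe] at h
  exact h

variable {κ M 𝔮} in
/-- **A class of `S_nr` is unramified at the chosen place above every `w ∤ p`** (conjugate `σ = 1`). [cite: GreenbergVatsal2000, §2 pp. 16–17] -/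
theorem mem_unramifiedKer_of_mem_unrSelmer {w : HeightOneSpectrum (𝓞 K)} (hw : ((p : ℕ) : 𝓞 K) ∉ w.asIdeal)
    {s : subgroupH1 κ.kerSubgroup M} (hs : s ∈ unrSelmer κ M 𝔮 ∅) : s ∈ unramifiedKer κ.kerSubgroup M w := by
  have h := (mem_unramifiedOutside_iff s).1 ((mem_datumSelmer_iff s).1 hs).1 w (Set.notMem_empty w) hw 1
  rwa [Literature.NumberTheory.EllipticCurves.conjH1_one_holds κ.kerSubgroup M, AddMonoidHom.id_apply] at h

variable {κ M 𝔮} in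
/-- **Membership in `S_nr` from the local conditions at the chosen places**: a class all of whose conjugates are unramified at the chosen
place above every `w ∤ p` and at the chosen place above `𝔮` (`res_{ker κ ∩ I_𝔮} = 0`) lies in `S_nr = datumSelmer (ker κ) M p (bdpData M p 𝔮) ∅`
(at the other primes above `p` Castella's datum is relaxed: no condition, `greenbergKer_relaxedDatum_eq_top`).
[cite: GreenbergVatsal2000, §2 pp. 16–17, 20] [cite: Castella2018, Def. 2.2] -/
theorem mem_unrSelmer_of_local (h𝔮 : ((p : ℕ) : 𝓞 K) ∈ 𝔮.asIdeal) {y : subgroupH1 κ.kerSubgroup M}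
    (haway : ∀ w : HeightOneSpectrum (𝓞 K), ((p : ℕ) : 𝓞 K) ∉ w.asIdeal → ∀ σ : absoluteGaloisGroup K,
      conjH1 κ.kerSubgroup M σ y ∈ unramifiedKer κ.kerSubgroup M w)
    (hq : ∀ σ : absoluteGaloisGroup K,
      resOfLe M (inf_le_left : κ.kerSubgroup ⊓ inertia 𝔮 ≤ κ.kerSubgroup) (conjH1 κ.kerSubgroup M σ y) = 0) :
    y ∈ unrSelmer κ M 𝔮 ∅ := by
  rw [unrSelmer, datumSelmerInfty_eq, mem_datumSelmer_iff]
  refine ⟨(mem_unramifiedOutside_iff y).2 fun w _ hw σ ↦ haway w hw σ, fun v hv σ ↦ ?_⟩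
  by_cases hvq : v = 𝔮
  · subst hvq
    rw [Castella2018.AcSelmer.bdpData_self p v hv, mem_greenbergKer_strictDatum_iff_resOfLe]
    exact hq σ
  · rw [Castella2018.AcSelmer.bdpData_of_ne p 𝔮 hv hvq, greenbergKer_relaxedDatum_eq_top]
    exact AddSubgroup.mem_top _

variable {κ M} in
/-- **The strict local lift from LOCAL invariance only** (JSW17: "`H¹(K_w, W) → H¹(K_w, M)^Γ` is surjective"): if `res_{ker κ ∩ D_w}` kills
`conj_d c − c` for every `d ∈ D_w`, then `res_{ker κ ∩ D_w} c` is restricted from `H¹(D_w, M)` (procyclic descent on `D_w`, any image of `κ|_{D_w}`).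
-w4 g9's `exists_resSubgroup_kerD_eq_of_forall` with its global hypothesis weakened to the local one it uses.
[cite: JetchevSkinnerWan2017, Lemma 3.3.3 (arXiv:1512.06894 p. 12)] [cite: SerreGaloisCohomology1997, I §2.6 (b)] -/
theorem exists_resSubgroup_kerD_eq_of_forall_local (hstab : ∀ m : M, IsOpen {σ : absoluteGaloisGroup K | σ • m = m})
    (htor : ∀ m : M, ∃ k : ℕ, p ^ k • m = 0) (w : HeightOneSpectrum (𝓞 K)) {c : subgroupH1 κ.kerSubgroup M}
    (hloc : ∀ d : decomp (K := K) w, Coinv.resKerD κ M w (conjH1 κ.kerSubgroup M (d : absoluteGaloisGroup K) c - c) = 0) :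
    ∃ z : subgroupH1 (decomp (K := K) w) M, ResKernel.resSubgroup (Coinv.kerD κ w) M z = Coinv.resKerD κ M w c := by
  haveI : CompactSpace (absoluteGaloisGroup K) := absoluteGaloisGroup_compactSpace K
  haveI : CompactSpace (decomp (K := K) w) := isCompact_iff_compactSpace.mp (Coinv.isClosed_decomp w).isCompact
  have hA : ∀ a : M, IsOpen {d : decomp (K := K) w | d • a = a} := fun a ↦ (hstab a).preimage continuous_subtype_val
  refine ProcyclicDescent.exists_resSubgroup_eq_of_forall_conjH1_eq hA (Coinv.kappaD κ w) htor (Coinv.resKerD κ M w c) fun d ↦ ?_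
  have e : conjH1 κ.kerSubgroup M (d : absoluteGaloisGroup K) c = c + (conjH1 κ.kerSubgroup M (d : absoluteGaloisGroup K) c - c) := by
    abel
  rw [← Coinv.resKerD_conjH1, e, map_add, hloc d, add_zero]

variable {κ M 𝔮} in
/-- **THE UNRAMIFIED LOCAL LIFT AT `𝔮`.** Let `c ∈ H¹(K_∞, M)` be such that `res_{ker κ ∩ I_𝔮}` kills `conj_d c − c` for every `d ∈ D_𝔮` (e.g. all
conjugates of `c` agree with `c` modulo `S_nr`), and assume h𝓛: for every `δ ∈ D_𝔮` outside `ker κ`, `conj_δ − 1` maps the local defect group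
`𝓛 = {ℓ ∈ H¹(ker κ ∩ D_𝔮, M) | res_{ker κ ∩ I_𝔮} ℓ = 0}` ONTO itself. Then there are `z ∈ H¹(D_𝔮, M)` and `ℓ ∈ 𝓛` with
`res_{D_𝔮 → D″} z = res_{D″} c − ℓ` — so `c − z` is UNRAMIFIED (not necessarily trivial) at the chosen place above `𝔮`. Proof: `x := res_{D″} c` is
`D_𝔮`-invariant modulo `𝓛` (`Coinv.resKerD_conjH1`); if `κ(D_𝔮) = 1` then `D″ = D_𝔮` and `x` is invariant (inner automorphisms); otherwise pick
`γ₀ ∈ D_𝔮` with `κ(γ₀) = p^a` generating `κ(D_𝔮)` (`ProcyclicDescent.imageIdeal_eq_bot_or`), correct `x` by `ℓ ∈ 𝓛` with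
`conj_{γ₀} ℓ − ℓ = conj_{γ₀} x − x` (h𝓛), and lift the `γ₀`-invariant `x − ℓ` by the rescaled descent
(`ProcyclicDescent.exists_resSubgroup_eq_of_conjH1_eq` for `rescale (κ|_{D_𝔮}) a`). In S3d's class (iii) `𝓛 ≅ W*` is divisible and `γ₀` acts on
it by a unit `u ≠ 1`, whence h𝓛. [cite: JetchevSkinnerWan2017, Lemma 3.3.3 (arXiv:1512.06894 p. 12)] [cite: GreenbergVatsal2000, §2 p. 17]
[cite: SerreGaloisCohomology1997, I §2.6 (b)] -/
theorem exists_resSubgroup_kerD_eq_sub_of_unr (hstab : ∀ m : M, IsOpen {σ : absoluteGaloisGroup K | σ • m = m})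
    (htor : ∀ m : M, ∃ k : ℕ, p ^ k • m = 0) {c : subgroupH1 κ.kerSubgroup M}
    (hinv : ∀ d : decomp (K := K) 𝔮,
      resH1Hom (Coinv.toKerD κ 𝔮 (kerSubgroup_inf_inertia_le_decomp κ 𝔮) (inf_le_left : κ.kerSubgroup ⊓ inertia 𝔮 ≤ κ.kerSubgroup))
        (AddMonoidHom.id M) (fun _ _ ↦ rfl)
        (Coinv.resKerD κ M 𝔮 (conjH1 κ.kerSubgroup M (d : absoluteGaloisGroup K) c - c)) = 0)
    (hL : ∀ δ : decomp (K := K) 𝔮, (δ : absoluteGaloisGroup K) ∉ κ.kerSubgroup →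
      ∀ a : subgroupH1 (Coinv.kerD κ 𝔮) M,
        resH1Hom (Coinv.toKerD κ 𝔮 (kerSubgroup_inf_inertia_le_decomp κ 𝔮) (inf_le_left : κ.kerSubgroup ⊓ inertia 𝔮 ≤ κ.kerSubgroup))
          (AddMonoidHom.id M) (fun _ _ ↦ rfl) a = 0 →
        ∃ ℓ : subgroupH1 (Coinv.kerD κ 𝔮) M,
          resH1Hom (Coinv.toKerD κ 𝔮 (kerSubgroup_inf_inertia_le_decomp κ 𝔮) (inf_le_left : κ.kerSubgroup ⊓ inertia 𝔮 ≤ κ.kerSubgroup))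
            (AddMonoidHom.id M) (fun _ _ ↦ rfl) ℓ = 0 ∧
          conjH1 (Coinv.kerD κ 𝔮) M δ ℓ - ℓ = a) :
    ∃ (z : subgroupH1 (decomp (K := K) 𝔮) M) (ℓ : subgroupH1 (Coinv.kerD κ 𝔮) M),
      resH1Hom (Coinv.toKerD κ 𝔮 (kerSubgroup_inf_inertia_le_decomp κ 𝔮) (inf_le_left : κ.kerSubgroup ⊓ inertia 𝔮 ≤ κ.kerSubgroup))
          (AddMonoidHom.id M) (fun _ _ ↦ rfl) ℓ = 0 ∧
      ResKernel.resSubgroup (Coinv.kerD κ 𝔮) M z = Coinv.resKerD κ M 𝔮 c - ℓ := by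
  haveI : CompactSpace (absoluteGaloisGroup K) := absoluteGaloisGroup_compactSpace K
  haveI : CompactSpace (decomp (K := K) 𝔮) := isCompact_iff_compactSpace.mp (Coinv.isClosed_decomp 𝔮).isCompact
  have hA : ∀ a : M, IsOpen {d : decomp (K := K) 𝔮 | d • a = a} := fun a ↦ (hstab a).preimage continuous_subtype_val
  set ρ := resH1Hom (Coinv.toKerD κ 𝔮 (kerSubgroup_inf_inertia_le_decomp κ 𝔮) (inf_le_left : κ.kerSubgroup ⊓ inertia 𝔮 ≤ κ.kerSubgroup))
    (AddMonoidHom.id M) (fun _ _ ↦ rfl) with hρ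
  set x := Coinv.resKerD κ M 𝔮 c with hx
  -- `conj_d x − x = resKerD (conj_d c − c)`
  have hdiff : ∀ d : decomp (K := K) 𝔮,
      conjH1 (Coinv.kerD κ 𝔮) M d x - x = Coinv.resKerD κ M 𝔮 (conjH1 κ.kerSubgroup M (d : absoluteGaloisGroup K) c - c) := by
    intro d
    rw [map_sub, Coinv.resKerD_conjH1]
  rcases ProcyclicDescent.imageIdeal_eq_bot_or (Coinv.kappaD κ 𝔮) with h0 | ⟨a, γ₀, hγ₀, hdiv⟩
  · -- `κ(D_𝔮) = 1`: every `d ∈ D_𝔮` lies in `D″`, so `x` is `D_𝔮`-invariant and lifts as is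
    have hxinv : ∀ g : decomp (K := K) 𝔮, conjH1 (Coinv.kerD κ 𝔮) M g x = x := fun g ↦ by
      rw [Literature.NumberTheory.EllipticCurves.conjH1_of_mem_holds (Coinv.kerD κ 𝔮) M ((MonoidHom.mem_ker).2 (h0 g)),
        AddMonoidHom.id_apply]
    obtain ⟨z, hz⟩ := ProcyclicDescent.exists_resSubgroup_eq_of_forall_conjH1_eq hA (Coinv.kappaD κ 𝔮) htor x hxinv
    exact ⟨z, 0, map_zero _, by rw [sub_zero]; exact hz⟩
  · -- `κ(D_𝔮) = p^a ℤ_p` with `κ(γ₀) = p^a`: correct `x` by an `ℓ ∈ 𝓛`, then descend along `rescale`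
    have hγ₀K : (γ₀ : absoluteGaloisGroup K) ∉ κ.kerSubgroup := by
      intro hmem
      rw [ZpExtension.mem_kerSubgroup] at hmem
      have h1 : (Coinv.kappaD κ 𝔮 γ₀).toAdd = 0 := by rw [Coinv.kappaD_apply, hmem, toAdd_one]
      rw [hγ₀] at h1
      exact pow_ne_zero a (Nat.cast_ne_zero.mpr (Fact.out : p.Prime).ne_zero) h1
    have hxL : ρ (conjH1 (Coinv.kerD κ 𝔮) M γ₀ x - x) = 0 := by
      rw [hdiff]
      exact hinv γ₀
    obtain ⟨ℓ, hℓ0, hℓ⟩ := hL γ₀ hγ₀K (conjH1 (Coinv.kerD κ 𝔮) M γ₀ x - x) hxL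
    -- `x − ℓ` is `γ₀`-invariant
    have hinv' : conjH1 (Coinv.kerD κ 𝔮) M γ₀ (x - ℓ) = x - ℓ := by
      rw [map_sub]
      have e : conjH1 (Coinv.kerD κ 𝔮) M γ₀ x - conjH1 (Coinv.kerD κ 𝔮) M γ₀ ℓ - (x - ℓ) =
          (conjH1 (Coinv.kerD κ 𝔮) M γ₀ x - x) - (conjH1 (Coinv.kerD κ 𝔮) M γ₀ ℓ - ℓ) := by abel
      rw [← sub_eq_zero, e, hℓ, sub_self]
    -- rescaled descent
    have hsurj := ProcyclicDescent.rescale_surjective (Coinv.kappaD κ 𝔮) a hdiv γ₀ hγ₀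
    have hone := ProcyclicDescent.rescale_eq_one (Coinv.kappaD κ 𝔮) a hdiv γ₀ hγ₀
    have e : ProcyclicDescent.kerK (ProcyclicDescent.rescale (Coinv.kappaD κ 𝔮) a hdiv) = Coinv.kerD κ 𝔮 :=
      ProcyclicDescent.kerK_rescale (Coinv.kappaD κ 𝔮) a hdiv
    set x' : subgroupH1 (ProcyclicDescent.kerK (ProcyclicDescent.rescale (Coinv.kappaD κ 𝔮) a hdiv)) M :=
      resOfLe M e.le (x - ℓ) with hx'
    have hx'inv : conjH1 (ProcyclicDescent.kerK (ProcyclicDescent.rescale (Coinv.kappaD κ 𝔮) a hdiv)) M γ₀ x' = x' := by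
      rw [hx', ← AddMonoidHom.comp_apply, ← resOfLe_comp_conjH1_holds (M := M) e.le γ₀, AddMonoidHom.comp_apply, hinv']
    obtain ⟨z, hz⟩ := ProcyclicDescent.exists_resSubgroup_eq_of_conjH1_eq hA γ₀
      (ProcyclicDescent.rescale (Coinv.kappaD κ 𝔮) a hdiv) hsurj hone htor x' hx'inv
    refine ⟨z, ℓ, hℓ0, ?_⟩
    rw [← ProcyclicDescent.resOfLe_comp_resSubgroup (A := M) e.ge, AddMonoidHom.comp_apply, hz, hx',
      ProcyclicDescent.resOfLe_resOfLe_of_eq (A := M) e]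

variable {κ M 𝔮} in
/-- **The unramified local lift at `𝔮`, read on `ker κ ∩ I_𝔮`**: under the hypotheses of `exists_resSubgroup_kerD_eq_sub_of_unr` (stated with
`res_{ker κ ∩ I_𝔮}`), there is `z ∈ H¹(D_𝔮, M)` with `res_{ker κ ∩ I_𝔮 ≤ D_𝔮} z = res_{ker κ ∩ I_𝔮 ≤ ker κ} c`.
[cite: JetchevSkinnerWan2017, Lemma 3.3.3 (arXiv:1512.06894 p. 12)] [cite: GreenbergVatsal2000, §2 p. 17] -/
theorem exists_resOfLe_inertia_eq_of_unr (hstab : ∀ m : M, IsOpen {σ : absoluteGaloisGroup K | σ • m = m})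
    (htor : ∀ m : M, ∃ k : ℕ, p ^ k • m = 0) {c : subgroupH1 κ.kerSubgroup M}
    (hinv : ∀ d : decomp (K := K) 𝔮,
      resOfLe M (inf_le_left : κ.kerSubgroup ⊓ inertia 𝔮 ≤ κ.kerSubgroup) (conjH1 κ.kerSubgroup M (d : absoluteGaloisGroup K) c - c) = 0)
    (hL : ∀ δ : decomp (K := K) 𝔮, (δ : absoluteGaloisGroup K) ∉ κ.kerSubgroup →
      ∀ a : subgroupH1 (Coinv.kerD κ 𝔮) M,
        resH1Hom (Coinv.toKerD κ 𝔮 (kerSubgroup_inf_inertia_le_decomp κ 𝔮) (inf_le_left : κ.kerSubgroup ⊓ inertia 𝔮 ≤ κ.kerSubgroup))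
          (AddMonoidHom.id M) (fun _ _ ↦ rfl) a = 0 →
        ∃ ℓ : subgroupH1 (Coinv.kerD κ 𝔮) M,
          resH1Hom (Coinv.toKerD κ 𝔮 (kerSubgroup_inf_inertia_le_decomp κ 𝔮) (inf_le_left : κ.kerSubgroup ⊓ inertia 𝔮 ≤ κ.kerSubgroup))
            (AddMonoidHom.id M) (fun _ _ ↦ rfl) ℓ = 0 ∧
          conjH1 (Coinv.kerD κ 𝔮) M δ ℓ - ℓ = a) :
    ∃ z : subgroupH1 (decomp (K := K) 𝔮) M,
      resOfLe M (kerSubgroup_inf_inertia_le_decomp κ 𝔮) z =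
        resOfLe M (inf_le_left : κ.kerSubgroup ⊓ inertia 𝔮 ≤ κ.kerSubgroup) c := by
  have hinv' : ∀ d : decomp (K := K) 𝔮,
      resH1Hom (Coinv.toKerD κ 𝔮 (kerSubgroup_inf_inertia_le_decomp κ 𝔮) (inf_le_left : κ.kerSubgroup ⊓ inertia 𝔮 ≤ κ.kerSubgroup))
        (AddMonoidHom.id M) (fun _ _ ↦ rfl)
        (Coinv.resKerD κ M 𝔮 (conjH1 κ.kerSubgroup M (d : absoluteGaloisGroup K) c - c)) = 0 := fun d ↦ by
    rw [← AddMonoidHom.comp_apply, toKerD_comp_resKerD]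
    exact hinv d
  obtain ⟨z, ℓ, hℓ0, hz⟩ := exists_resSubgroup_kerD_eq_sub_of_unr hstab htor hinv' hL
  refine ⟨z, ?_⟩
  have h1 := congrArg (resH1Hom (Coinv.toKerD κ 𝔮 (kerSubgroup_inf_inertia_le_decomp κ 𝔮)
    (inf_le_left : κ.kerSubgroup ⊓ inertia 𝔮 ≤ κ.kerSubgroup)) (AddMonoidHom.id M) (fun _ _ ↦ rfl)) hz
  rw [map_sub, hℓ0, sub_zero, ← AddMonoidHom.comp_apply, toKerD_comp_resSubgroup, ← AddMonoidHom.comp_apply,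
    toKerD_comp_resKerD] at h1
  exact h1

variable {M} in
/-- **A class whose cocycle vanishes on an open normal `N₁ ≥ I_w` is unramified at the chosen place above `w`** (`GreenbergSelmer.inertia w` is
the inertia group of `𝔓₀ = adicCompletionPrime K w`, `inertia_adicCompletionPrime_eq_map_absInertia`). [cite: NeukirchANT1999, Ch. II §9 Prop. (9.6)]
[cite: SerreGaloisCohomology1997, I §2.4] -/
theorem oneCocycleClass_mem_unramifiedKer_of_inertia_le (φ : contOneCocycles (discreteTopRep κ.kerSubgroup M))
    {N₁ : Subgroup (absoluteGaloisGroup K)} (hN₁ : ∀ (h : absoluteGaloisGroup K) (hh : h ∈ κ.kerSubgroup), h ∈ N₁ → φ.1 ⟨h, hh⟩ = 0)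
    {w : HeightOneSpectrum (𝓞 K)} (hI : (adicCompletionPrime K w).inertia (absoluteGaloisGroup K) ≤ N₁) :
    oneCocycleClass _ φ ∈ unramifiedKer κ.kerSubgroup M w := by
  rw [GreenbergVatsal2000.unramifiedKer, AddMonoidHom.mem_ker, CocycleCriteria.resH1Hom_oneCocycleClass_eq_zero_iff]
  refine ⟨0, fun x ↦ ?_⟩
  rw [smul_zero, sub_zero, AddMonoidHom.id_apply]
  have hx := (mem_inertiaIn_iff κ.kerSubgroup w x).1 x.2
  have hxI : ((x : decomp (K := K) w) : absoluteGaloisGroup K) ∈ (adicCompletionPrime K w).inertia (absoluteGaloisGroup K) := by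
    rw [inertia_adicCompletionPrime_eq_map_absInertia]
    exact hx.2
  exact hN₁ _ hx.1 (hI hxI)

end Generic

end Summit.BirchSwinnertonDyer.BirchSwinnertonDyer.Theorems.PrintCf2.UnrBaseLift

end
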